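import Summits.Ventures.CertifiedQuantumChemistry.Rows.ConjectureSU
import Literature.MathematicalPhysics.QuantumChemistry.RelaxationSymmetryAveraging
import Mathlib.Logic.Equiv.Fin.Rotate
import HarnessLib

/-!
# Ventures/CertifiedQuantumChemistry — Rows/HubbardRingTVDihedralSymmetry.lean: the DIHEDRAL SYMMETRY of
# the TV-H ring tables and its use in the `S_z`-sector relaxation — translation/reflection blocking is
# LOSSLESS, an invariant OPTIMAL pair exists, and at such a pair the site occupations are uniform
# (`N_σ/L`; `= 1/2` at half filling) and the doublon weights are equal

HONEST FRAMING (verbatim): certified bounds for a stated model Hamiltonian in a stated basis; not a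
claim about the real molecule beyond that model.

Seat rdm-B, ROWS courtesy file (theorems only; no `def`, no notation, no instance; zero compute). The
tree's Gatermann–Parrilo file `Literature/…/RelaxationSymmetryAveraging.lean` proves, for ANY orbital
symmetry group of the integral tables, that the `S_z`-sector DQG programme keeps its value on the
invariant pairs and attains it at an invariant pair (group average of a minimiser). This file supplies
the ring INSTANCE and reads off the consequences (STRUCTURE §2.2.8 "local half filling", here EXACT at a
symmetric optimum — complementing gen 36's a-priori `(Re n_p − 1)² ≤ Re d_p + Re e_p` for ALL optima):

* §1 `RingSymmetry.ringAdj_iff_add_one`, `ringAdj_finRotate_iff`, `ringAdj_rev_iff`: the adjacency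
  `Hamiltonians.ringAdj` is invariant under the rotation `finRotate L` (`p ↦ p + 1`) and the reflection
  `Fin.rev` (`p ↦ L − 1 − p`).
* §2 `hubbardRingTV_h_perm`, `hubbardRingTV_eri_perm`, `ringAdj_perm_iff_of_mem_dihedral`,
  **`hubbardRingTV_tables_dihedral`**: both tables of `hubbardRingTV L t U` are invariant under every
  element of the subgroup of `Equiv.Perm (Fin L)` generated by `{finRotate L, Fin.revPerm}` (adjacency
  preservation is a subgroup property — `Subgroup.closure_induction`).
* §3 **`hubbardRingTV_le_pqgSectorEnergy_iff_dihedral`** (dihedral blocking is LOSSLESS) and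
  **`hubbardRingTV_exists_dihedral_optimum`** (an OPTIMAL dihedral-invariant sector-feasible pair EXISTS;
  every `a, b ≤ L`, `t`, `U`).
* §4 CONSEQUENCES of entrywise rotation invariance: `finRotate_pow_apply_eq_add`,
  `exists_finRotate_pow_apply_eq` (transitivity); `one_diag_eq`, `one_bond_eq`, `two_doublon_eq`
  (occupations, nearest-neighbour hops, doublon weights are site-independent); with the sector rows
  **`one_diag_up_eq_div`** / **`one_diag_down_eq_div`** (`γ_{p↑,p↑} = N_α/L`, `γ_{p↓,p↓} = N_β/L`),
  `two_doublon_eq_div` (`d_p = s/L`).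
* §5 **`hubbardRingTV_exists_uniform_optimum`** (an OPTIMAL pair with `γ_{p↑,p↑} = a/L`, `γ_{p↓,p↓} = b/L`,
  `d_p = s/L` at every site); **`hubbardRingTV_exists_halfFilled_optimum`** (`L = 2n`, sector `(n, n)`:
  an optimal pair with `γ_{pσ,pσ} = 1/2` at every site and spin).

READING: statements about the ABSTRACT sector programme on the cell's own model object (singlet level
and spin flip NOT treated); no certificate, row, claim node or value of record depends on this file; no
certified primal point is asserted or read. All PROVED (0 sorry, standard axioms); no defs, no named
facts. References (docstring-only): Gatermann–Parrilo, J. Pure Appl. Algebra 192 (2004) 95, §3 Thm 3.3;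
Mazziotti, Adv. Chem. Phys. 134 (2007) ch. 3 §II.F. Tree (REUSED): `le_pqgSectorEnergy_iff_invariant`,
`exists_invariant_isDQGFeasibleSector_rdmEnergy_eq_pqgSectorEnergy`, `Orb.mapEquiv_orb`. Mathlib:
`finRotate_apply`, `Fin.last_sub`, `Subgroup.closure_induction`, `Fin.cast_val_eq_self` (`Fin.CommRing`).
-/

noncomputable section

namespace Summit.Ventures.CertifiedQuantumChemistry

open Matrix Finset
open Literature.MathematicalPhysics.QuantumLattice Literature.MathematicalPhysics.QuantumChemistry
open Summit.Ventures.CertifiedQuantumChemistry.Hamiltonians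
open scoped ComplexOrder

namespace RingSymmetry

/-! ## §1 The ring adjacency is dihedral-invariant -/

section Adjacency

variable {L : ℕ}

/-- `p ~ q` on the `L`-ring iff `p ≠ q` and `q = p + 1` or `p = q + 1` in `Fin L` (addition mod `L`). -/
theorem ringAdj_iff_add_one [NeZero L] (p q : Fin L) :
    Hamiltonians.ringAdj L p q ↔ p ≠ q ∧ (p + 1 = q ∨ q + 1 = p) := by
  have h1 : ∀ x y : Fin L, ((x.val + 1) % L = y.val) ↔ x + 1 = y := by
    intro x y
    rw [Fin.ext_iff, Fin.val_add, Fin.val_one', Nat.add_mod_mod]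
  unfold Hamiltonians.ringAdj
  rw [h1, h1]

/-- **The adjacency is rotation-invariant**: `(p + 1) ~ (q + 1) ↔ p ~ q`. -/
theorem ringAdj_finRotate_iff (p q : Fin L) :
    Hamiltonians.ringAdj L (finRotate L p) (finRotate L q) ↔ Hamiltonians.ringAdj L p q := by
  haveI : NeZero L := ⟨(Fin.pos p).ne'⟩
  rw [ringAdj_iff_add_one, ringAdj_iff_add_one, finRotate_apply, finRotate_apply]
  simp only [ne_eq, add_left_inj]

open Fin.CommRing in
/-- **The adjacency is reflection-invariant**: `rev p ~ rev q ↔ p ~ q` (`rev p = L − 1 − p`). -/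
theorem ringAdj_rev_iff (p q : Fin L) :
    Hamiltonians.ringAdj L (Fin.rev p) (Fin.rev q) ↔ Hamiltonians.ringAdj L p q := by
  haveI : NeZero L := ⟨(Fin.pos p).ne'⟩
  obtain ⟨n, rfl⟩ := Nat.exists_eq_succ_of_ne_zero (NeZero.ne L)
  rw [ringAdj_iff_add_one, ringAdj_iff_add_one, Fin.rev_injective.ne_iff]
  simp only [← Fin.last_sub]
  have e1 : Fin.last n - p + 1 = Fin.last n - q ↔ q + 1 = p := by
    constructor <;> intro h <;> linear_combination h
  have e2 : Fin.last n - q + 1 = Fin.last n - p ↔ p + 1 = q := by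
    constructor <;> intro h <;> linear_combination h
  rw [e1, e2, or_comm]

end Adjacency

/-! ## §2 The TV-H tables are dihedral-invariant -/

section Tables

variable {L : ℕ}

/-- The one-electron table is invariant under every adjacency-preserving permutation of the sites. -/
theorem hubbardRingTV_h_perm {e : Equiv.Perm (Fin L)}
    (he : ∀ p q, Hamiltonians.ringAdj L (e p) (e q) ↔ Hamiltonians.ringAdj L p q)
    (t U : ℚ) (p q : Fin L) : (hubbardRingTV L t U).h (e p) (e q) = (hubbardRingTV L t U).h p q := by
  simp only [hubbardRingTV, he p q]

/-- The two-electron table `(pp|pp) = U` is invariant under EVERY permutation of the sites. -/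
theorem hubbardRingTV_eri_perm (e : Equiv.Perm (Fin L)) (t U : ℚ) (p q r s : Fin L) :
    (hubbardRingTV L t U).eri (e p) (e q) (e r) (e s) = (hubbardRingTV L t U).eri p q r s := by
  simp only [hubbardRingTV, e.injective.eq_iff]

/-- **Adjacency preservation is a subgroup property**: every element of the subgroup of
`Equiv.Perm (Fin L)` generated by the rotation `finRotate L` and the reflection `Fin.revPerm` (the
dihedral group of the ring) preserves `ringAdj`. -/
theorem ringAdj_perm_iff_of_mem_dihedral {x : Equiv.Perm (Fin L)}
    (hx : x ∈ Subgroup.closure ({finRotate L, Fin.revPerm} : Set (Equiv.Perm (Fin L)))) (p q : Fin L) :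
    Hamiltonians.ringAdj L (x p) (x q) ↔ Hamiltonians.ringAdj L p q := by
  revert p q
  refine Subgroup.closure_induction
    (p := fun (x : Equiv.Perm (Fin L)) _ => ∀ p q, Hamiltonians.ringAdj L (x p) (x q) ↔ Hamiltonians.ringAdj L p q)
    ?_ ?_ ?_ ?_ hx
  · intro x hxS p q
    rcases (Set.mem_insert_iff.1 hxS) with rfl | h2
    · exact ringAdj_finRotate_iff p q
    · rw [Set.mem_singleton_iff.1 h2, Fin.revPerm_apply, Fin.revPerm_apply]
      exact ringAdj_rev_iff p q
  · exact fun p q => Iff.rfl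
  · intro x y _ _ hx' hy' p q
    rw [Equiv.Perm.mul_apply, Equiv.Perm.mul_apply, hx', hy']
  · intro x _ hx' p q
    simpa only [Equiv.Perm.coe_inv, Equiv.apply_symm_apply] using (hx' (x.symm p) (x.symm q)).symm

/-- **THE TV-H TABLES ARE DIHEDRAL-INVARIANT**: for every `x` in the dihedral subgroup both integral
tables of `hubbardRingTV L t U` are invariant under the site relabelling `x`. -/
theorem hubbardRingTV_tables_dihedral (t U : ℚ) {x : Equiv.Perm (Fin L)}
    (hx : x ∈ Subgroup.closure ({finRotate L, Fin.revPerm} : Set (Equiv.Perm (Fin L)))) :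
    (∀ p q, (hubbardRingTV L t U).h (x p) (x q) = (hubbardRingTV L t U).h p q) ∧
      ∀ p q r s, (hubbardRingTV L t U).eri (x p) (x q) (x r) (x s) = (hubbardRingTV L t U).eri p q r s :=
  ⟨hubbardRingTV_h_perm (ringAdj_perm_iff_of_mem_dihedral hx) t U, hubbardRingTV_eri_perm x t U⟩

end Tables

end RingSymmetry

/-! ## §3 Losslessness of dihedral blocking and an invariant optimal pair -/

section Optimum

variable {L : ℕ}

open RingSymmetry

/-- **DIHEDRAL BLOCKING IS LOSSLESS FOR THE `S_z`-SECTOR PROGRAMME OF THE RING**: for `a, b ≤ L`, a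
number `c` lies below `OPT_DQG(hubbardRingTV L t U; a, b)` iff it lies below the functional on the
sector-feasible pairs that are INVARIANT under every rotation and reflection of the sites (the tree's
Gatermann–Parrilo Theorem 3.3, `le_pqgSectorEnergy_iff_invariant`, on the dihedral subgroup). [folklore] -/
theorem hubbardRingTV_le_pqgSectorEnergy_iff_dihedral (t U : ℚ) {a b : ℕ} (ha : a ≤ L) (hb : b ≤ L)
    {c : ℝ} :
    c ≤ Model.pqgSectorEnergy (hubbardRingTV L t U) a b ↔
      ∀ γ Γ, IsDQGFeasibleSector a b γ Γ →
        (∀ x ∈ Subgroup.closure ({finRotate L, Fin.revPerm} : Set (Equiv.Perm (Fin L))),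
            γ.submatrix (Orb.mapEquiv x) (Orb.mapEquiv x) = γ ∧
              Γ.submatrix (Prod.map (Orb.mapEquiv x) (Orb.mapEquiv x))
                (Prod.map (Orb.mapEquiv x) (Orb.mapEquiv x)) = Γ) →
          c ≤ (rdmEnergy (fun p q => ((hubbardRingTV L t U).h p q : ℂ))
            (fun p q r s => ((hubbardRingTV L t U).eri p q r s : ℂ))
            ((hubbardRingTV L t U).ecore : ℂ) γ Γ).re := by
  classical
  have ha' : a ≤ Fintype.card (Fin L) := by rw [Fintype.card_fin]; exact ha
  have hb' : b ≤ Fintype.card (Fin L) := by rw [Fintype.card_fin]; exact hb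
  set H := Subgroup.closure ({finRotate L, Fin.revPerm} : Set (Equiv.Perm (Fin L)))
  have hh : ∀ (x : ↥H) (p q : Fin L), ((hubbardRingTV L t U).h (H.subtype x p) (H.subtype x q) : ℂ) =
      ((hubbardRingTV L t U).h p q : ℂ) := fun x p q => by rw [Subgroup.coe_subtype, (hubbardRingTV_tables_dihedral t U x.2).1]
  have hg : ∀ (x : ↥H) (p q r s : Fin L), ((hubbardRingTV L t U).eri (H.subtype x p) (H.subtype x q)
      (H.subtype x r) (H.subtype x s) : ℂ) = ((hubbardRingTV L t U).eri p q r s : ℂ) := fun x p q r s => by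
    rw [Subgroup.coe_subtype, (hubbardRingTV_tables_dihedral t U x.2).2]
  unfold Model.pqgSectorEnergy
  rw [le_pqgSectorEnergy_iff_invariant _ _ _ ha' hb' H.subtype hh hg]
  simp only [MonoidHom.coe_comp, Function.comp_apply, Orb.mapPerm_apply, Subgroup.coe_subtype,
    Subtype.forall]

/-- **AN OPTIMAL DIHEDRAL-INVARIANT PAIR EXISTS**: for every `t, U` and `a, b ≤ L` the `(a, b)` sector
programme of `hubbardRingTV L t U` has an optimal feasible pair (`Re E(γ, Γ) = OPT_DQG`) whose 1- and
2-matrices are invariant under the site relabelling by every rotation and reflection of the ring (the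
group average of a minimiser, `exists_invariant_isDQGFeasibleSector_rdmEnergy_eq_pqgSectorEnergy`).
[folklore] -/
theorem hubbardRingTV_exists_dihedral_optimum (t U : ℚ) {a b : ℕ} (ha : a ≤ L) (hb : b ≤ L) :
    ∃ γ Γ, IsDQGFeasibleSector a b γ Γ ∧
      (∀ x ∈ Subgroup.closure ({finRotate L, Fin.revPerm} : Set (Equiv.Perm (Fin L))),
          γ.submatrix (Orb.mapEquiv x) (Orb.mapEquiv x) = γ ∧
            Γ.submatrix (Prod.map (Orb.mapEquiv x) (Orb.mapEquiv x))
              (Prod.map (Orb.mapEquiv x) (Orb.mapEquiv x)) = Γ) ∧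
        (rdmEnergy (fun p q => ((hubbardRingTV L t U).h p q : ℂ))
            (fun p q r s => ((hubbardRingTV L t U).eri p q r s : ℂ))
            ((hubbardRingTV L t U).ecore : ℂ) γ Γ).re = Model.pqgSectorEnergy (hubbardRingTV L t U) a b := by
  classical
  have ha' : a ≤ Fintype.card (Fin L) := by rw [Fintype.card_fin]; exact ha
  have hb' : b ≤ Fintype.card (Fin L) := by rw [Fintype.card_fin]; exact hb
  set H := Subgroup.closure ({finRotate L, Fin.revPerm} : Set (Equiv.Perm (Fin L)))
  have hh : ∀ (x : ↥H) (p q : Fin L), ((hubbardRingTV L t U).h (H.subtype x p) (H.subtype x q) : ℂ) =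
      ((hubbardRingTV L t U).h p q : ℂ) := fun x p q => by rw [Subgroup.coe_subtype, (hubbardRingTV_tables_dihedral t U x.2).1]
  have hg : ∀ (x : ↥H) (p q r s : Fin L), ((hubbardRingTV L t U).eri (H.subtype x p) (H.subtype x q)
      (H.subtype x r) (H.subtype x s) : ℂ) = ((hubbardRingTV L t U).eri p q r s : ℂ) := fun x p q r s => by
    rw [Subgroup.coe_subtype, (hubbardRingTV_tables_dihedral t U x.2).2]
  obtain ⟨γ, Γ, hf, hinv, hE⟩ := exists_invariant_isDQGFeasibleSector_rdmEnergy_eq_pqgSectorEnergy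
    (fun p q => ((hubbardRingTV L t U).h p q : ℂ)) (fun p q r s => ((hubbardRingTV L t U).eri p q r s : ℂ))
    ((hubbardRingTV L t U).ecore : ℂ) ha' hb' H.subtype hh hg
  refine ⟨γ, Γ, hf, fun x hx => ?_, hE⟩
  simpa only [MonoidHom.coe_comp, Function.comp_apply, Orb.mapPerm_apply, Subgroup.coe_subtype] using
    hinv ⟨x, hx⟩

end Optimum

/-! ## §4 Consequences of rotation invariance: uniform occupations, hops and doublon weights -/

namespace RingSymmetry

section Consequences

variable {L : ℕ}
variable {γ : Matrix (Orb (Fin L)) (Orb (Fin L)) ℂ}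
  {Γ : Matrix (Orb (Fin L) × Orb (Fin L)) (Orb (Fin L) × Orb (Fin L)) ℂ}

open Fin.CommRing in
/-- The `k`-th power of the rotation adds `k`: `(finRotate L)^k p = p + k` in `Fin L` (with the scoped
ring structure of `Fin L`). -/
theorem finRotate_pow_apply_eq_add [NeZero L] (k : ℕ) (p : Fin L) :
    (finRotate L ^ k) p = p + (k : Fin L) := by
  induction k with
  | zero => simp
  | succ k ih =>
    rw [pow_succ', Equiv.Perm.mul_apply, ih, finRotate_apply, Nat.cast_succ, add_assoc]

open Fin.CommRing in
/-- **The rotations act transitively on the sites**: `(finRotate L)^k q = p` for `k = (p − q) mod L`. -/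
theorem exists_finRotate_pow_apply_eq (p q : Fin L) : ∃ k : ℕ, (finRotate L ^ k) q = p := by
  haveI : NeZero L := ⟨(Fin.pos p).ne'⟩
  exact ⟨(p - q).val, by rw [finRotate_pow_apply_eq_add, Fin.cast_val_eq_self, add_sub_cancel]⟩

/-- Entrywise rotation invariance of the 1-matrix propagates to all powers of the rotation. -/
theorem one_apply_finRotate_pow
    (hγ : ∀ (p q : Fin L) (σ τ : Fin 2), γ (orb (finRotate L p) σ) (orb (finRotate L q) τ) = γ (orb p σ) (orb q τ))
    (k : ℕ) (p q : Fin L) (σ τ : Fin 2) :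
    γ (orb ((finRotate L ^ k) p) σ) (orb ((finRotate L ^ k) q) τ) = γ (orb p σ) (orb q τ) := by
  induction k with
  | zero => simp
  | succ k ih => rw [pow_succ', Equiv.Perm.mul_apply, Equiv.Perm.mul_apply, hγ, ih]

/-- **SITE OCCUPATIONS ARE UNIFORM** at a rotation-invariant 1-matrix: `γ_{pσ,pσ} = γ_{qσ,qσ}`. -/
theorem one_diag_eq
    (hγ : ∀ (p q : Fin L) (σ τ : Fin 2), γ (orb (finRotate L p) σ) (orb (finRotate L q) τ) = γ (orb p σ) (orb q τ))
    (p q : Fin L) (σ : Fin 2) : γ (orb p σ) (orb p σ) = γ (orb q σ) (orb q σ) := by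
  obtain ⟨k, hk⟩ := exists_finRotate_pow_apply_eq p q
  rw [← hk, one_apply_finRotate_pow hγ]

/-- **NEAREST-NEIGHBOUR HOPS ARE UNIFORM** at a rotation-invariant 1-matrix:
`γ_{pσ,(p+1)τ} = γ_{qσ,(q+1)τ}`. -/
theorem one_bond_eq
    (hγ : ∀ (p q : Fin L) (σ τ : Fin 2), γ (orb (finRotate L p) σ) (orb (finRotate L q) τ) = γ (orb p σ) (orb q τ))
    (p q : Fin L) (σ τ : Fin 2) :
    γ (orb p σ) (orb (finRotate L p) τ) = γ (orb q σ) (orb (finRotate L q) τ) := by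
  obtain ⟨k, hk⟩ := exists_finRotate_pow_apply_eq p q
  have hcomm : finRotate L ((finRotate L ^ k) q) = (finRotate L ^ k) (finRotate L q) := by
    rw [← Equiv.Perm.mul_apply, ← Equiv.Perm.mul_apply, ← pow_succ', ← pow_succ]
  rw [← hk, hcomm, one_apply_finRotate_pow hγ]

/-- Entrywise rotation invariance of the 2-matrix propagates to all powers of the rotation. -/
theorem two_apply_finRotate_pow
    (hΓ : ∀ (p q r s : Fin L) (σ τ υ φ : Fin 2),
      Γ (orb (finRotate L p) σ, orb (finRotate L q) τ) (orb (finRotate L r) υ, orb (finRotate L s) φ) =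
        Γ (orb p σ, orb q τ) (orb r υ, orb s φ))
    (k : ℕ) (p q r s : Fin L) (σ τ υ φ : Fin 2) :
    Γ (orb ((finRotate L ^ k) p) σ, orb ((finRotate L ^ k) q) τ)
        (orb ((finRotate L ^ k) r) υ, orb ((finRotate L ^ k) s) φ) = Γ (orb p σ, orb q τ) (orb r υ, orb s φ) := by
  induction k with
  | zero => simp
  | succ k ih => simp only [pow_succ', Equiv.Perm.mul_apply, hΓ, ih]

/-- **DOUBLON WEIGHTS ARE UNIFORM** at a rotation-invariant 2-matrix: `d_p = d_q`,
`d_p = Γ_{(p↑,p↓),(p↑,p↓)}`. -/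
theorem two_doublon_eq
    (hΓ : ∀ (p q r s : Fin L) (σ τ υ φ : Fin 2),
      Γ (orb (finRotate L p) σ, orb (finRotate L q) τ) (orb (finRotate L r) υ, orb (finRotate L s) φ) =
        Γ (orb p σ, orb q τ) (orb r υ, orb s φ))
    (p q : Fin L) :
    Γ (orb p 0, orb p 1) (orb p 0, orb p 1) = Γ (orb q 0, orb q 1) (orb q 0, orb q 1) := by
  obtain ⟨k, hk⟩ := exists_finRotate_pow_apply_eq p q
  rw [← hk, two_apply_finRotate_pow hΓ]

/-- A constant family on `Fin L` summing to `c` is `c / L` termwise. -/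
theorem eq_div_of_sum_eq_of_const {f : Fin L → ℂ} (hconst : ∀ p q, f p = f q) {c : ℂ} (hsum : ∑ p, f p = c)
    (p : Fin L) : f p = c / L := by
  have hL : (L : ℂ) ≠ 0 := Nat.cast_ne_zero.2 (Fin.pos p).ne'
  have h2 : ∑ q : Fin L, f q = (L : ℂ) * f p := by
    rw [Finset.sum_congr rfl fun q _ => hconst q p, Finset.sum_const, Finset.card_univ, Fintype.card_fin,
      nsmul_eq_mul]
  rw [eq_div_iff hL, mul_comm, ← h2, hsum]

/-- **`γ_{p↑,p↑} = N_α / L`** at every site of a rotation-invariant `(a, b)`-sector-feasible pair. -/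
theorem one_diag_up_eq_div {a b : ℕ} (hf : IsDQGFeasibleSector a b γ Γ)
    (hγ : ∀ (p q : Fin L) (σ τ : Fin 2), γ (orb (finRotate L p) σ) (orb (finRotate L q) τ) = γ (orb p σ) (orb q τ))
    (p : Fin L) : γ (orb p 0) (orb p 0) = (a : ℂ) / L :=
  eq_div_of_sum_eq_of_const (f := fun p => γ (orb p 0) (orb p 0)) (fun p q => one_diag_eq hγ p q 0)
    hf.trace_up p

/-- **`γ_{p↓,p↓} = N_β / L`** at every site of a rotation-invariant `(a, b)`-sector-feasible pair. -/
theorem one_diag_down_eq_div {a b : ℕ} (hf : IsDQGFeasibleSector a b γ Γ)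
    (hγ : ∀ (p q : Fin L) (σ τ : Fin 2), γ (orb (finRotate L p) σ) (orb (finRotate L q) τ) = γ (orb p σ) (orb q τ))
    (p : Fin L) : γ (orb p 1) (orb p 1) = (b : ℂ) / L :=
  eq_div_of_sum_eq_of_const (f := fun p => γ (orb p 1) (orb p 1)) (fun p q => one_diag_eq hγ p q 1)
    hf.trace_down p

/-- **`d_p = s / L`** (`s = Σ_q d_q`, the total doublon weight) at every site of a rotation-invariant `Γ`. -/
theorem two_doublon_eq_div
    (hΓ : ∀ (p q r s : Fin L) (σ τ υ φ : Fin 2),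
      Γ (orb (finRotate L p) σ, orb (finRotate L q) τ) (orb (finRotate L r) υ, orb (finRotate L s) φ) =
        Γ (orb p σ, orb q τ) (orb r υ, orb s φ))
    (p : Fin L) :
    Γ (orb p 0, orb p 1) (orb p 0, orb p 1) = (∑ q : Fin L, Γ (orb q 0, orb q 1) (orb q 0, orb q 1)) / L :=
  eq_div_of_sum_eq_of_const (f := fun q => Γ (orb q 0, orb q 1) (orb q 0, orb q 1))
    (fun p q => two_doublon_eq hΓ p q) rfl p

/-- From the submatrix form of invariance (the averaging theorem's) to the entrywise forms above. -/
theorem entrywise_of_submatrix {x : Equiv.Perm (Fin L)}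
    (h1 : γ.submatrix (Orb.mapEquiv x) (Orb.mapEquiv x) = γ)
    (h2 : Γ.submatrix (Prod.map (Orb.mapEquiv x) (Orb.mapEquiv x))
      (Prod.map (Orb.mapEquiv x) (Orb.mapEquiv x)) = Γ) :
    (∀ (p q : Fin L) (σ τ : Fin 2), γ (orb (x p) σ) (orb (x q) τ) = γ (orb p σ) (orb q τ)) ∧
      ∀ (p q r s : Fin L) (σ τ υ φ : Fin 2),
        Γ (orb (x p) σ, orb (x q) τ) (orb (x r) υ, orb (x s) φ) = Γ (orb p σ, orb q τ) (orb r υ, orb s φ) := by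
  refine ⟨fun p q σ τ => ?_, fun p q r s σ τ υ φ => ?_⟩
  · have h := congrFun (congrFun h1 (orb p σ)) (orb q τ)
    rwa [submatrix_apply, Orb.mapEquiv_orb, Orb.mapEquiv_orb] at h
  · have h := congrFun (congrFun h2 (orb p σ, orb q τ)) (orb r υ, orb s φ)
    simp only [submatrix_apply, Prod.map_apply, Orb.mapEquiv_orb] at h
    exact h

end Consequences

end RingSymmetry

/-! ## §5 A uniform optimal pair; local half filling at a symmetric optimum -/

section Uniform

variable {L : ℕ}

open RingSymmetry

/-- **A UNIFORM OPTIMAL PAIR EXISTS**: for every `t, U` and `a, b ≤ L` the `(a, b)` sector programme of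
`hubbardRingTV L t U` has an OPTIMAL feasible pair with site-independent occupations `γ_{p↑,p↑} = a/L`,
`γ_{p↓,p↓} = b/L` and site-independent doublon weight `d_p = s/L` (any dihedral-invariant optimum of §3
is one). [folklore] -/
theorem hubbardRingTV_exists_uniform_optimum (t U : ℚ) {a b : ℕ} (ha : a ≤ L) (hb : b ≤ L) :
    ∃ γ Γ, IsDQGFeasibleSector a b γ Γ ∧
      (rdmEnergy (fun p q => ((hubbardRingTV L t U).h p q : ℂ))
          (fun p q r s => ((hubbardRingTV L t U).eri p q r s : ℂ))
          ((hubbardRingTV L t U).ecore : ℂ) γ Γ).re = Model.pqgSectorEnergy (hubbardRingTV L t U) a b ∧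
      (∀ p : Fin L, γ (orb p 0) (orb p 0) = (a : ℂ) / L) ∧
      (∀ p : Fin L, γ (orb p 1) (orb p 1) = (b : ℂ) / L) ∧
      ∀ p : Fin L, Γ (orb p 0, orb p 1) (orb p 0, orb p 1) =
        (∑ q : Fin L, Γ (orb q 0, orb q 1) (orb q 0, orb q 1)) / L := by
  obtain ⟨γ, Γ, hf, hinv, hE⟩ := hubbardRingTV_exists_dihedral_optimum (L := L) t U ha hb
  have hr : finRotate L ∈ Subgroup.closure ({finRotate L, Fin.revPerm} : Set (Equiv.Perm (Fin L))) :=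
    Subgroup.subset_closure (Set.mem_insert _ _)
  obtain ⟨hγ, hΓ⟩ := entrywise_of_submatrix (hinv _ hr).1 (hinv _ hr).2
  exact ⟨γ, Γ, hf, hE, one_diag_up_eq_div hf hγ, one_diag_down_eq_div hf hγ, two_doublon_eq_div hΓ⟩

/-- **LOCAL HALF FILLING AT A SYMMETRIC OPTIMUM**: on the half-filled even ring (`L = 2n`, `n ≥ 1`,
sector `(n, n)`, every `t, U`) the `S_z`-sector DQG programme of `hubbardRingTV (2n) t U` has an optimal
feasible pair with `γ_{pσ,pσ} = 1/2` at EVERY site and spin (and uniform doublon weight). [folklore] -/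
theorem hubbardRingTV_exists_halfFilled_optimum {n : ℕ} (hn : 1 ≤ n) (t U : ℚ) :
    ∃ γ Γ, IsDQGFeasibleSector n n γ Γ ∧
      (rdmEnergy (fun p q => ((hubbardRingTV (2 * n) t U).h p q : ℂ))
          (fun p q r s => ((hubbardRingTV (2 * n) t U).eri p q r s : ℂ))
          ((hubbardRingTV (2 * n) t U).ecore : ℂ) γ Γ).re = Model.pqgSectorEnergy (hubbardRingTV (2 * n) t U) n n ∧
      (∀ (p : Fin (2 * n)) (σ : Fin 2), γ (orb p σ) (orb p σ) = 1 / 2) ∧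
      ∀ p q : Fin (2 * n), Γ (orb p 0, orb p 1) (orb p 0, orb p 1) = Γ (orb q 0, orb q 1) (orb q 0, orb q 1) := by
  obtain ⟨γ, Γ, hf, hE, hup, hdown, hd⟩ :=
    hubbardRingTV_exists_uniform_optimum (L := 2 * n) t U (show n ≤ 2 * n by omega) (show n ≤ 2 * n by omega)
  have hhalf : ((n : ℂ)) / ((2 * n : ℕ) : ℂ) = 1 / 2 := by
    have hn0 : (n : ℂ) ≠ 0 := Nat.cast_ne_zero.2 (by omega)
    rw [Nat.cast_mul, Nat.cast_ofNat]
    field_simp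
  refine ⟨γ, Γ, hf, hE, fun p σ => ?_, fun p q => by rw [hd p, hd q]⟩
  fin_cases σ
  · exact (hup p).trans hhalf
  · exact (hdown p).trans hhalf

end Uniform

end Summit.Ventures.CertifiedQuantumChemistry

end
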